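import Literature.AlgebraicGeometry.Morphisms.CechH2ResolutionDimTwo
import Literature.AlgebraicGeometry.Morphisms.CechModuleFiniteLocallyFreePullback
import Literature.AlgebraicGeometry.Morphisms.CechModuleCoverIndependence
import Literature.AlgebraicGeometry.Morphisms.CechModuleUnit
import Literature.AlgebraicGeometry.Modules.IdealSheafOfClosedImmersion
import Literature.AlgebraicGeometry.Resolution.RationalSurfaceSingularitiesBasic
import HarnessLib

/-!
# `H¹(𝒪_C) = 0` for every closed subscheme `C` of a resolution with `H¹(X, 𝒪_X) = 0` of a surface germ
# (Lipman 1969, the `χ = h⁰` dictionary of §27 / proof of (12.1), p. 220: "`H¹(𝒪_C)` vanishes, `𝒪_C` being a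
# homomorphic image of `𝒪_X`")

Topic: `Literature/AlgebraicGeometry/Resolution`.  PROVED, fact-free, definition-free.  J. Lipman, *Rational
singularities, with applications to algebraic surfaces and unique factorization*, Publ. Math. IHÉS 36 (1969),
uses throughout §§12–14, 27 (proof of Thm. (12.1), p. 220: "Since the fibres of `f` have dimension `≤ 1`,
`H²(ℱ) = 0` for all coherent `𝒪_X`-modules `ℱ`"; proof of Thm. (27.1), p. 276: "Since `H¹(𝒪_C)` vanishes
(`𝒪_C` being a homomorphic image of `𝒪_X`) …") the remark that on `f : X → Spec A` proper with fibres of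
dimension `≤ 1` and `H¹(X, 𝒪_X) = 0`, EVERY quotient `𝒪_X/𝒥` has `H¹ = 0` (the long exact sequence of
`0 → 𝒥 → 𝒪_X → 𝒪_X/𝒥 → 0` and `H²(𝒥) = 0`).  This is the step "`h¹(E) = h¹(2E) = 0`, `χ(E) = h⁰(E)`" of the
`h⁰`-dictionary under which the tree renders Prop. (13.1) b), d) and Thm. (27.1), Cor. (27.3) over a rational
surface singularity (`Resolution/Lipman1969RationalContraction`, `Resolution/Lipman1969IntersectionTheory`).

In the tree's Čech vocabulary (`HasTrivialCechH1 g`: `Ȟ¹(𝒱, 𝒪) = 0` for every finite affine open cover `𝒱`):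

* `hasTrivialCechH1_comp_of_cechMapH1_algebraUnit_surjective` — for ANY `π : X → Spec A` (`X` quasi-compact)
  and any closed immersion `ι : Z → X`: if `Ȟ¹(𝒰, 𝒪_X) → Ȟ¹(𝒰, ι_*𝒪_Z)` (induced by `ι♯ : 𝒪_X → ι_*𝒪_Z`,
  `Modules.algebraUnit`) is onto for every finite affine open cover `𝒰` of `X`, then
  `Ȟ¹(X, 𝒪) = 0 ⇒ Ȟ¹(Z, 𝒪) = 0` (`Ȟ¹(𝒰, ι_*𝒪_Z) = Ȟ¹(ι⁻¹𝒰, 𝒪_Z)`, `Morphisms/CechModuleFiniteLocallyFreePullback`;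
  independence of the affine cover on `Z`, `Morphisms/CechModuleCoverIndependence`);
* **`IsResolution.hasTrivialCechH1_comp_of_isClosedImmersion`** — for `A` a Noetherian local domain of Krull
  dimension `2`, `π : X → Spec A` a resolution (`X` integral) with `H¹(X, 𝒪_X) = 0` and `ι : Z → X` a closed
  immersion, `H¹(Z, 𝒪_Z) = 0` (`HasTrivialCechH1 (ι ≫ π)`): the surjectivity is the tree's right exactness of
  `Ȟ¹` on the resolution for short exact sequences with coherent kernel
  (`Morphisms.cechMapH1_surjective_of_isResolution_of_coh`, i.e. `Ȟ² = 0`, Görtz–Wedhorn II Cor. 24.44 for the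
  resolution, proved in the tree without formal functions) applied to `0 → 𝓘_Z → 𝒪_X → ι_*𝒪_Z → 0`
  (`Modules.shortExact_idealSheafOf`, `Modules.coh_idealSheafOf`);
* `IsResolution.hasTrivialCechH1_subschemeι_comp` — the same for Mathlib's closed subscheme `V(𝓘)` of an ideal
  sheaf `𝓘 : X.IdealSheafData` (the curves `E`, `2E`, `E + F = V(𝓘_E 𝓘_F)` of §13);
* `hasTrivialCechH1_subschemeι_comp_of_hasRationalSingularity` — the rational regime as the named facts
  `Lipman1969_13_1_b_rat` / `_d_rat` / `_27_1_reg_rat` / `_27_3_rat` quantify it (`S` normal of dimension `2`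
  with a rational singularity, `π` a desingularization), with `H¹(X, 𝒪_X) = 0` for THIS `π` supplied by the
  named fact `Lipman1969_1_2` (Prop. (1.2) 2); explicit hypothesis `h12` — the conclusion is conditional on it
  exactly as the dictionary is in print).

No summit statement is proved; nothing here bears on resolution of singularities in positive characteristic.

## References
* J. Lipman, Publ. Math. IHÉS 36 (1969): proof of Thm. (12.1) (p. 220), §13 (p. 223), proof of Thm. (27.1)
  (p. 276). [Lipman1969]
* U. Görtz, T. Wedhorn, *Algebraic Geometry II* (2023), Cor. 24.44, Cor. 21.81, Lemma 22.1. [GortzWedhorn2023]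
* R. Hartshorne, *Algebraic Geometry* (1977), III Ex. 4.1, III Thm. 4.5. [Hartshorne1977]
* The Stacks Project, Tags 01QN, 02KE. [StacksProject]
-/

noncomputable section

open CategoryTheory CategoryTheory.Limits AlgebraicGeometry TopologicalSpace IsLocalRing
open Literature.AlgebraicGeometry.Morphisms Literature.AlgebraicGeometry.Modules

universe u

namespace Literature.AlgebraicGeometry.Resolution

/-! ## A finite affine open cover indexed in the universe of the scheme -/

/-- A quasi-compact scheme has a finite affine open cover indexed by a type in its own universe. [folklore] -/
private theorem exists_finite_isAffineOpen_cover' (X : Scheme.{u}) [CompactSpace X] :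
    ∃ (κ : Type u) (_ : Finite κ) (U : κ → X.Opens), (∀ i, IsAffineOpen (U i)) ∧ ⨆ i, U i = ⊤ := by
  obtain ⟨s, hs, e⟩ := (isCompact_iff_finite_and_eq_biUnion_affineOpens (U := (⊤ : X.Opens))).mp
    (by simpa using isCompact_univ)
  haveI := hs.to_subtype
  refine ⟨s, inferInstance, fun i => i.1.1, fun i => i.1.2, ?_⟩
  rw [iSup_subtype]
  exact e.symm

/-! ## `Ȟ¹ = 0` passes to a closed subscheme when `Ȟ¹(𝒪_X) → Ȟ¹(ι_*𝒪_Z)` is onto -/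

section General

variable {A : Type u} [CommRing A] {X Z : Scheme.{u}} (π : X ⟶ Spec (.of A)) (ι : Z ⟶ X)

/-- **`H¹(X, 𝒪_X) = 0 ⇒ H¹(Z, 𝒪_Z) = 0` for a closed subscheme `ι : Z → X` along which `Ȟ¹(𝒰, 𝒪_X) → Ȟ¹(𝒰, ι_*𝒪_Z)`
is surjective on every finite affine open cover `𝒰` of `X`** ("`H¹(𝒪_C)` vanishes, `𝒪_C` being a homomorphic
image of `𝒪_X`", granted right exactness of `H¹`): `Ȟ¹(𝒰, ι_*𝒪_Z) = Ȟ¹(ι⁻¹𝒰, 𝒪_Z)` (same Čech complex), and on the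
scheme `Z` the vanishing of `Ȟ¹` of the quasi-coherent `𝒪_Z` does not depend on the finite affine cover.
[cite: Lipman1969, proof of Theorem (27.1) (p. 276)] [cite: Hartshorne1977, III Ex. 4.1] -/
theorem hasTrivialCechH1_comp_of_cechMapH1_algebraUnit_surjective [CompactSpace X] [IsClosedImmersion ι]
    (hRE : ∀ (κ : Type u) [Finite κ] (U : κ → X.Opens), (∀ i, IsAffineOpen (U i)) → ⨆ i, U i = ⊤ →
      Function.Surjective (cechMapH1 π (algebraUnit ι) U))
    (h1 : HasTrivialCechH1 π) : HasTrivialCechH1 (ι ≫ π) := by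
  intro κ' _ V hVaff hVcov
  -- a finite affine open cover `𝒰` of `X`; `Ȟ¹(𝒰, 𝒪_X) = 0`
  obtain ⟨κ, _, U, hUaff, hUcov⟩ := exists_finite_isAffineOpen_cover' X
  haveI : Subsingleton (CechMH1 π (unitModule X) U) := by
    rw [show CechMH1 π (unitModule X) U = CechH1 π U from CechMH1_unit π U]
    exact h1 κ U hUaff hUcov
  -- `Ȟ¹(𝒰, ι_*𝒪_Z) = 0` by the surjectivity
  haveI : Subsingleton (CechMH1 π ((Scheme.Modules.pushforward ι).obj (unitModule Z)) U) :=
    ⟨fun a b => by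
      obtain ⟨a', rfl⟩ := hRE κ U hUaff hUcov a
      obtain ⟨b', rfl⟩ := hRE κ U hUaff hUcov b
      rw [Subsingleton.elim a' b']⟩
  -- `= Ȟ¹(ι⁻¹𝒰, 𝒪_Z)`
  have hpre : Subsingleton (CechMH1 (ι ≫ π) (unitModule Z) (fun i => ι ⁻¹ᵁ U i)) :=
    (subsingleton_cechMH1_pushforward_iff π ι (unitModule Z) U).mp inferInstance
  -- cover independence on `Z`: `ι⁻¹𝒰` and `𝒱` are two finite affine open covers of `Z`
  have hpreaff : ∀ i, IsAffineOpen (ι ⁻¹ᵁ U i) := fun i => (hUaff i).preimage ι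
  have hprecov : ⨆ i, ι ⁻¹ᵁ U i = ⊤ := by
    rw [← Scheme.Hom.preimage_iSup, hUcov]; exact Opens.map_top _
  have hV : Subsingleton (CechMH1 (ι ≫ π) (unitModule Z) V) :=
    (subsingleton_cechMH1_iff_of_isAffineOpen (ι ≫ π) IsAffineLocalizing.unit (fun i => ι ⁻¹ᵁ U i) V
      hpreaff hVaff hprecov hVcov).mp hpre
  rwa [show CechMH1 (ι ≫ π) (unitModule Z) V = CechH1 (ι ≫ π) V from CechMH1_unit (ι ≫ π) V] at hV

end General

/-! ## On a resolution of a two-dimensional local domain with `H¹(X, 𝒪_X) = 0` -/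

section Resolution

variable {A : Type u} [CommRing A] [IsNoetherianRing A] [IsLocalRing A] [IsDomain A]
  {X : Scheme.{u}} [IsIntegral X] [IsLocallyNoetherian X] (π : X ⟶ Spec (.of A))

/-- **`H¹(Z, 𝒪_Z) = 0` for every closed subscheme `Z` of a resolution `π : X → Spec A` of a two-dimensional
Noetherian local domain with `H¹(X, 𝒪_X) = 0`** (Lipman's dictionary step "`H¹(𝒪_C)` vanishes, `𝒪_C` being a
homomorphic image of `𝒪_X`", with "`H²(ℱ) = 0` since the fibres have dimension `≤ 1`"): the long exact Čech
sequence of `0 → 𝓘_Z → 𝒪_X → ι_*𝒪_Z → 0` (`Modules.shortExact_idealSheafOf`; `𝓘_Z` coherent) and the tree's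
`Ȟ² = 0` on the resolution (`Morphisms.cechMapH1_surjective_of_isResolution_of_coh`).
[cite: Lipman1969, proof of Theorem (12.1) (p. 220) and proof of Theorem (27.1) (p. 276)]
[cite: GortzWedhorn2023, Cor. 24.44] -/
theorem IsResolution.hasTrivialCechH1_comp_of_isClosedImmersion (hA : ringKrullDim A = 2)
    (hπ : IsResolution π) (h1 : HasTrivialCechH1 π) {Z : Scheme.{u}} (ι : Z ⟶ X) [IsClosedImmersion ι] :
    HasTrivialCechH1 (ι ≫ π) := by
  haveI : IsProper π := hπ.isProper
  haveI : CompactSpace X := QuasiCompact.compactSpace_of_compactSpace π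
  exact hasTrivialCechH1_comp_of_cechMapH1_algebraUnit_surjective π ι
    (fun κ _ U hUaff hUcov =>
      cechMapH1_surjective_of_isResolution_of_coh hA hπ (shortExact_idealSheafOf ι) (coh_idealSheafOf ι)
        U hUaff hUcov)
    h1

/-- **`H¹(𝒪_{V(𝓘)}) = 0` for every ideal sheaf `𝓘`** on a resolution of a two-dimensional Noetherian local domain
with `H¹(X, 𝒪_X) = 0` — the closed subschemes `E = V(𝓘_η)`, `2E = V(𝓘_η²)`, `E + F = V(𝓘_{η′}𝓘_η)` of §13 all
have `h¹ = 0`, so that `χ = h⁰` for them (`Resolution.h0`).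
[cite: Lipman1969, Section 13 (p. 223) with proof of Theorem (12.1) (p. 220)] -/
theorem IsResolution.hasTrivialCechH1_subschemeι_comp (hA : ringKrullDim A = 2) (hπ : IsResolution π)
    (h1 : HasTrivialCechH1 π) (𝓘 : X.IdealSheafData) : HasTrivialCechH1 (𝓘.subschemeι ≫ π) :=
  hπ.hasTrivialCechH1_comp_of_isClosedImmersion π hA h1 𝓘.subschemeι

end Resolution

/-! ## The rational regime of the named facts (13.1) b), d)_rat, (27.1), (27.3) -/

/-- **The `χ = h⁰` dictionary over a rational surface singularity**: for `S` a two-dimensional normal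
Noetherian local domain with a rational singularity, `π : X → Spec S` ANY desingularization and `𝓘` any ideal
sheaf on `X`, `H¹(𝒪_{V(𝓘)}) = 0` — GIVEN Prop. (1.2) 2) (`H¹(X, 𝒪_X) = 0` for every desingularization; the named
fact `Lipman1969_1_2`, hypothesis `h12`).  This is the sense in which `h0 π 𝓘 = χ(𝒪_{V(𝓘)})` in
`Lipman1969RationalContraction` / `Lipman1969IntersectionTheory`.
[cite: Lipman1969, Section 27 (p. 276) with Proposition (1.2) 2) (p. 199)] -/
theorem hasTrivialCechH1_subschemeι_comp_of_hasRationalSingularity (h12 : Lipman1969_1_2.{u})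
    {S : Type u} [CommRing S] [IsNoetherianRing S] [IsLocalRing S] [IsDomain S] [IsIntegrallyClosed S]
    (hdim : ringKrullDim S = 2) (hrat : HasRationalSingularity S)
    {X : Scheme.{u}} (π : X ⟶ Spec (.of S)) (hπ : IsResolution π) (𝓘 : X.IdealSheafData) :
    HasTrivialCechH1 (𝓘.subschemeι ≫ π) := by
  haveI : IsIntegral X := hπ.isIntegral_source
  haveI : IsProper π := hπ.isProper
  haveI : IsLocallyNoetherian X := LocallyOfFiniteType.isLocallyNoetherian π
  exact hπ.hasTrivialCechH1_subschemeι_comp π hdim (h12.hasTrivialCechH1_of_isResolution hdim hrat π hπ) 𝓘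

end Literature.AlgebraicGeometry.Resolution

end
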